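import Summits.BirchSwinnertonDyer.BirchSwinnertonDyer.Theorems.PrintCf2RubinValueTwoColemanCoinvariantCharOfClosure
import Summits.BirchSwinnertonDyer.BirchSwinnertonDyer.Theorems.PrintCf2RubinValueTwoColemanCoinvariantCharUnits
import Literature.NumberTheory.GaloisRepresentations.LubinTateColemanCoordCoinvariantContinuousTwo
import Literature.NumberTheory.GaloisRepresentations.LubinTateColemanUnitsImageTopologyTwo
import HarnessLib

/-!
# Brick (c) at `p = 2`, local `χ`-part, CLOSURE FORM: for `C = 𝒞̄` the closure of the group generated by a family of principal coherent tower
# units `β_𝔠` satisfying II §2.4 (ii), **`char_Λ ((N / Col C)_ε) = char_Λ (Λ / (L_ε))`**, `L_ε` THE series with `φ_ε(Col β_𝔠) = (t_{χ(σ̃_𝔠)} − N𝔠)·L_ε`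
# — de Shalit III §1.4 (5) ("`i(𝒞̄_𝔣) = μ(𝔣)Λ₀`") + Lemma 1.10 (17) at `q = 2`, one prime, `d = 1`, over `Λ = 𝒪_F⟦X⟧⟦T⟧`

Cell `bsd-print-cf2`, width seat `bsd-line-cf2c-w7` g13, route C `PrintCf2RubinValueTwo`, crux of record stmt-BirchSwinnertonDyer-24033
`TwoVariableMainConjAtSplitTwoQuad` (23720 nominal), BRICK §4(c); `--supports` the crux as a helper.  THEOREMS ONLY (0 sorry, no named fact, no
`def … : Prop`); Theses-free.  BSD is not proved by any of this.

Composition of the seat's one-stop form `ColemanImage.charIdeal_coinvariants_colemanImage_eq` (g12: `char((N/Col C)_ε) = char(Λ/φ_ε(Col C))` for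
every closed `Γ_F`-stable subgroup `C ⊆ 𝒰¹_∞`), the sandwich `ColemanCoinvariantUnits.charIdeal_colemanCoinvariants_eq_of_units_sandwich` (g13 S15) and
the continuity file `LubinTateColemanCoordCoinvariantContinuousTwo` (g13 S16: `φ_ε` continuous, ideals of `Λ` closed):

* ★ `colemanImageSubmodule₁_subset_closure` — if `C` lies in the CLOSURE of the monoid generated by the `β_𝔠` and their inverses, then `Col(C)` lies in
  the closure of the additive subgroup generated by the `Col β_𝔠` (`Col` is a continuous homomorphism: `continuous_colemanImage`, `colemanImage_mul/_inv/_one`);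
* ★★ `map_colemanImageSubmodule₁_eq` — hence **`φ_ε(Col C) = (L_ε)·J_ε`** as soon as `φ_ε(Col β_𝔠) = (t_{χ(σ̃_𝔠)} − N𝔠)·L_ε` for every `𝔠` (III §1.4 (5));
* ★★★ `charIdeal_coinvariants_colemanImage_eq_of_units` — under the levelwise relation's auxiliary indices (`χ(σ̃_{a₁}) = γ`, `π ∣ n_{a₁} − 1`;
  `(t_{χ(σ̃_{a₂})} − n_{a₂})(n_{a₁} − 1) ≠ 0`) and `L_ε ≠ 0`: **`char_Λ ((N / Col C)_ε) = char_Λ (Λ/(L_ε))`** — the LEFT side is LITERALLY that of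
  `charIdeal_coinvariants_colemanImage_eq`; ★★ `exists_charIdeal_coinvariants_colemanImage_eq_of_units` produces `L_ε` from the levelwise unit relation
  (`existsUnique_colemanDeltaCoinvFun_colemanImageCoh_eq_mul`).

What remains OUTSIDE this file for the local (c)-identity `char (𝒰/𝒞̄)_χ = (μ(𝔣)_χ)` of de Shalit III (17): the measure lane's inputs (`β_𝔞 = (e(𝔞)_{𝔓,m})_m` as
principal coherent tower families with `hrel_ellipticUnitsLocal` at every level and `σ̃_𝔞` fixing `E_∞`), `𝒞̄` closed / `Γ_F`-stable (II §2.4 (ii) + density),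
the non-vanishing `L_ε ≠ 0` (a non-zero `L`-value, (31)), and `Λ` factorial for `char(Λ/(L)) = (L)` (`…_span` forms).

## References
* [deShalit1987] E. de Shalit, *Iwasawa theory of elliptic curves with complex multiplication* (1987), II §2.4 (ii), §4.12 (29)–(33); III §1.4 (5),
  Cor. 1.5 (7), Lemma 1.10 (17).
* [Washington1997] L. C. Washington, *Introduction to Cyclotomic Fields* (1997), §13.2.
* [BourbakiGT1] N. Bourbaki, *General Topology*, Ch. I §2.1, §9.4 Cor. 2.
-/

noncomputable section

set_option linter.dupNamespace false
set_option autoImplicit false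

open Filter Topology
open scoped PowerSeries.WithPiTopology

namespace Summit.BirchSwinnertonDyer.BirchSwinnertonDyer.Theorems.PrintCf2.ColemanCoinvariantClosure

open Literature.NumberTheory.GaloisRepresentations Literature.NumberTheory.GaloisRepresentations.IsNonarchimedeanLocalField
  Literature.NumberTheory.GaloisRepresentations.LubinTate ValuativeRel Field
open Literature.NumberTheory.EllipticCurves
open Summit.BirchSwinnertonDyer.BirchSwinnertonDyer.Theorems.PrintCf2.ColemanImage
open Summit.BirchSwinnertonDyer.BirchSwinnertonDyer.Theorems.PrintCf2.ColemanCoinvariantUnits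

variable {F : Type} [Field F] [ValuativeRel F] [TopologicalSpace F] [IsNonarchimedeanLocalField F]

attribute [local instance] ltNormUniformSpace ltNormIsUniformAddGroup rk1 nF nE fintypeResidueField
attribute [local instance] RelNormCoherentUnits.instCommMonoid

variable {p : ℕ} [hp : Fact p.Prime] {d : ℕ} (hd : d.Coprime p)
variable {π : 𝒪[F]} (hπ : (valuation F).IsUniformizer (π : F))
variable (E : ℕ → IntermediateField F (AlgebraicClosure F)) [∀ m, FiniteDimensional F (E m)] [∀ m, Normal F (E m)]
  [∀ m, IsGalois F (E m)] (hmono : Monotone E) (hE : ∀ m, E m ≤ maxUnramified F) (hdeg : ∀ m, Module.finrank F (E m) = d * p ^ m)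
  {σ₀ : absoluteGaloisGroup F} (hσ₀ : IsAbsArithFrob σ₀) (hq : residueFieldCard F = 2)
variable (u : (LTCoeff F)ˣ) (hu : LTCoeff.of F π = residueFieldCard F * u) (γ w : 𝒪[F]ˣ) (hγ : (γ : 𝒪[F]) = 1 + π ^ 2 * w)
variable [IsAdicComplete (Ideal.span {intBase F (LTCoeff.of F π)}) (PowerSeries 𝒪[F])] [NeZero d]
variable {θ : ∀ m, unitBall (E m)} (hθ : ∀ m, IsIntegralNormalGen (E m) (θ m))
  (hcoh : ∀ m, unitBallTrace (hmono (Nat.le_succ m)) (θ (m + 1)) = θ m)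
variable [CharZero F] [IsAdicComplete (Ideal.span {(p : 𝒪[F])}) 𝒪[F]] (hI : Ideal.span {(p : 𝒪[F])} ≠ ⊤)
  (hud : ∀ m, (u : LTCoeff F) ^ Module.finrank F (E m) ≠ 1) (hm : ∃ m₁ : ℕ, LTCoeff.of F π ^ 2 ∣ LTCoeff.of F π - m₁)
variable [Unique (ZMod d)] (hN : DenseRange (Nat.cast : ℕ → 𝒪[F]))
  (C : Set (∀ m, RelNormCoherentUnits hπ (E m))) (hC : IsClosed C) (hCsub : C ⊆ principalCoherentFamilies hπ E hmono)
  (h1 : (fun m => (RelNormCoherentUnits.one : RelNormCoherentUnits hπ (E m))) ∈ C)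
  (hmul : ∀ β ∈ C, ∀ β' ∈ C, (fun m => (β m).mul (β' m)) ∈ C) (hinv : ∀ β ∈ C, (fun m => (β m).inv hπ (E m)) ∈ C)
  (hgal : ∀ σ : absoluteGaloisGroup F, ∀ β ∈ C, (fun m => (β m).galAct σ) ∈ C)
variable {I : Type*} (β : I → ∀ m, RelNormCoherentUnits hπ (E m)) (hβC : ∀ c, β c ∈ C)

/-! ## §1. `Col(C)` lies in the closure of the subgroup generated by the `Col β_c` -/

omit hp [∀ m, FiniteDimensional F (E m)] [∀ m, Normal F (E m)] [∀ m, IsGalois F (E m)] [NeZero d] [CharZero F]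
  [IsAdicComplete (Ideal.span {(p : 𝒪[F])}) 𝒪[F]] in
/-- Reading a `ℤ/d`-indexed family at the unique index (plumbing for `unitsImage₁` / `colemanImageSubmodule₁`). [cite: deShalit1987, I §3.8 (17)] -/
theorem funUnique_coe_apply (G : ZMod d → ColemanCoordModule hπ hq (intBase F) u hu γ) :
    (LinearEquiv.funUnique (ZMod d) (PowerSeries (PowerSeries 𝒪[F])) (ColemanCoordModule hπ hq (intBase F) u hu γ) :
      (ZMod d → ColemanCoordModule hπ hq (intBase F) u hu γ) →ₗ[PowerSeries (PowerSeries 𝒪[F])] ColemanCoordModule hπ hq (intBase F) u hu γ) G =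
      G default := by
  rw [LinearEquiv.coe_coe, LinearEquiv.funUnique_apply]
  exact congrArg G (Subsingleton.elim _ _)

omit [IsAdicComplete (Ideal.span {intBase F (LTCoeff.of F π)}) (PowerSeries 𝒪[F])] [CharZero F] [Unique (ZMod d)] in
include hdeg h1 hmul hinv hβC in
/-- The monoid generated by the `β_c` and their inverses lies in `C`, and `Col` maps it into the additive subgroup generated by the `Col β_c`
(`Col` is a homomorphism). [cite: deShalit1987, I §3.4 Lemma (i); III §1.4] -/
theorem closure_le_and_colemanImage_mem (s : ∀ m, RelNormCoherentUnits hπ (E m))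
    (hs : s ∈ Submonoid.closure (Set.range β ∪ Set.range fun c => fun m => ((β c) m).inv hπ (E m))) :
    s ∈ C ∧ ∀ hs' : s ∈ principalCoherentFamilies hπ E hmono,
      colemanImage hd hπ E hmono hE hdeg hσ₀ hq u hu γ hθ hcoh hs'.1 default ∈
        AddSubgroup.closure (Set.range fun c => colemanImage hd hπ E hmono hE hdeg hσ₀ hq u hu γ hθ hcoh (hCsub (hβC c)).1 default) := by
  -- the target property is a submonoid containing the generators
  let T : Submonoid (∀ m, RelNormCoherentUnits hπ (E m)) :=
    { carrier := {s | s ∈ C ∧ ∀ hs' : s ∈ principalCoherentFamilies hπ E hmono,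
        colemanImage hd hπ E hmono hE hdeg hσ₀ hq u hu γ hθ hcoh hs'.1 default ∈
          AddSubgroup.closure (Set.range fun c => colemanImage hd hπ E hmono hE hdeg hσ₀ hq u hu γ hθ hcoh (hCsub (hβC c)).1 default)}
      mul_mem' := by
        rintro s t ⟨hsC, hs⟩ ⟨htC, ht⟩
        refine ⟨hmul s hsC t htC, fun hst => ?_⟩
        have e := colemanImage_mul hd hπ E hmono hE hdeg hσ₀ hq u hu γ hθ hcoh (hCsub hsC).1 (hCsub htC).1 hst.1
        change colemanImage hd hπ E hmono hE hdeg hσ₀ hq u hu γ hθ hcoh (β := fun m => (s m).mul (t m)) hst.1 default ∈ _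
        rw [e, Pi.add_apply]
        exact AddSubgroup.add_mem _ (hs (hCsub hsC)) (ht (hCsub htC))
      one_mem' := by
        refine ⟨h1, fun h1' => ?_⟩
        change colemanImage hd hπ E hmono hE hdeg hσ₀ hq u hu γ hθ hcoh
          (β := fun m => (RelNormCoherentUnits.one : RelNormCoherentUnits hπ (E m))) h1'.1 default ∈ _
        rw [colemanImage_one hd hπ E hmono hE hdeg hσ₀ hq u hu γ hθ hcoh, Pi.zero_apply]
        exact AddSubgroup.zero_mem _ }
  have hgen : (Set.range β ∪ Set.range fun c => fun m => ((β c) m).inv hπ (E m)) ⊆ (T : Set _) := by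
    rintro s (⟨c, rfl⟩ | ⟨c, rfl⟩)
    · exact ⟨hβC c, fun hs' => AddSubgroup.subset_closure ⟨c, rfl⟩⟩
    · refine ⟨hinv _ (hβC c), fun hs' => ?_⟩
      rw [colemanImage_inv hd hπ E hmono hE hdeg hσ₀ hq u hu γ hθ hcoh (hCsub (hβC c)), Pi.neg_apply]
      exact AddSubgroup.neg_mem _ (AddSubgroup.subset_closure ⟨c, rfl⟩)
  exact Submonoid.closure_le.mpr hgen hs

omit [CharZero F] in
include hdeg h1 hmul hinv hβC in
/-- ★ **`Col(C) ⊆ closure ⟨Col β_c⟩`** when `C` lies in the closure of the monoid generated by the `β_c` and their inverses (`Col` is continuous: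
`continuous_colemanImage`). [cite: deShalit1987, III §1.4; I §3.7] [cite: BourbakiGT1, Ch. I §2.1] -/
theorem colemanImageSubmodule₁_subset_closure
    (hCgen : C ⊆ closure (Submonoid.closure (Set.range β ∪ Set.range fun c => fun m => ((β c) m).inv hπ (E m)) : Set _)) :
    (colemanImageSubmodule₁ hd hπ E hmono hE hdeg hσ₀ hq u hu γ hθ hcoh hN C hC hCsub h1 hmul hinv hgal :
        Set (ColemanCoordModule hπ hq (intBase F) u hu γ)) ⊆
      closure (AddSubgroup.closure (Set.range fun c =>
        colemanImage hd hπ E hmono hE hdeg hσ₀ hq u hu γ hθ hcoh (hCsub (hβC c)).1 default) : Set (ColemanCoordModule hπ hq (intBase F) u hu γ)) := by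
  intro y hy
  obtain ⟨G, hG, rfl⟩ := (Submodule.mem_map.mp hy)
  obtain ⟨β', hβ', hβ'C, rfl⟩ := (mem_colemanImageSet_iff hd hπ E hmono hE hdeg hσ₀ hq u hu γ hθ hcoh).mp
    ((mem_colemanImageSubmodule hd hπ E hmono hE hdeg hσ₀ hq u hu γ hθ hcoh).mp hG)
  rw [funUnique_coe_apply]
  -- the continuous map `Φ : 𝒰¹_∞ → M₁`, `β ↦ Col(β)(default)`
  let Φ : principalCoherentFamilies hπ E hmono → ColemanCoordModule hπ hq (intBase F) u hu γ :=
    fun b => colemanImage hd hπ E hmono hE hdeg hσ₀ hq u hu γ hθ hcoh b.2.1 default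
  have hΦ : Continuous Φ := (continuous_apply default).comp (continuous_colemanImage hd hπ E hmono hE hdeg hσ₀ hq u hu γ hθ hcoh)
  -- `⟨β', hβ'⟩` lies in the closure (in the subtype) of the preimage of the generated monoid
  set G₀ : Set (∀ m, RelNormCoherentUnits hπ (E m)) :=
    ((Submonoid.closure (Set.range β ∪ Set.range fun c => fun m => ((β c) m).inv hπ (E m)) :
      Submonoid (∀ m, RelNormCoherentUnits hπ (E m))) : Set (∀ m, RelNormCoherentUnits hπ (E m))) with hG₀
  have hG₀sub : G₀ ⊆ principalCoherentFamilies hπ E hmono := fun s hs =>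
    hCsub (closure_le_and_colemanImage_mem hd hπ E hmono hE hdeg hσ₀ hq u hu γ hθ hcoh C hCsub h1 hmul hinv β hβC s hs).1
  have hmem : (⟨β', hβ'⟩ : principalCoherentFamilies hπ E hmono) ∈
      closure ((Subtype.val : principalCoherentFamilies hπ E hmono → _) ⁻¹' G₀) := by
    rw [Topology.IsInducing.subtypeVal.closure_eq_preimage_closure_image, Set.mem_preimage]
    have e : (Subtype.val : principalCoherentFamilies hπ E hmono → _) '' (Subtype.val ⁻¹' G₀) = G₀ := by
      rw [Set.image_preimage_eq_inter_range, Subtype.range_coe_subtype]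
      exact Set.inter_eq_left.mpr hG₀sub
    rw [e]
    exact hCgen hβ'C
  have hmaps : Set.MapsTo Φ ((Subtype.val : principalCoherentFamilies hπ E hmono → _) ⁻¹' G₀)
      (AddSubgroup.closure (Set.range fun c =>
        colemanImage hd hπ E hmono hE hdeg hσ₀ hq u hu γ hθ hcoh (hCsub (hβC c)).1 default) : Set _) := fun b hb =>
    (closure_le_and_colemanImage_mem hd hπ E hmono hE hdeg hσ₀ hq u hu γ hθ hcoh C hCsub h1 hmul hinv β hβC b.1 hb).2 b.2
  have h : Φ ⟨β', hβ'⟩ ∈ closure (AddSubgroup.closure (Set.range fun c =>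
      colemanImage hd hπ E hmono hE hdeg hσ₀ hq u hu γ hθ hcoh (hCsub (hβC c)).1 default) : Set _) :=
    map_mem_closure hΦ hmem hmaps
  exact h

/-! ## §2. `φ_ε(Col C) = (L_ε)·J_ε` and the characteristic ideal -/

variable (ε : PowerSeries (PowerSeries 𝒪[F])) (σ : I → absoluteGaloisGroup F) (n : I → ℕ)

omit [CharZero F] in
include hdeg h1 hmul hinv hβC in
/-- ★★ **`φ_ε(Col C) = (L_ε)·J_ε`** (de Shalit III §1.4 (5): `i(𝒞̄) = μ(𝔣)Λ₀`, `ε`-part, `J_ε = Λ₀`-analogue the ideal of the `t_{χ(σ̃_c)} − n_c`): from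
`φ_ε(Col β_c) = (t_{χ(σ̃_c)} − n_c)·L_ε` for every `c` and `C ⊆` the closure of the monoid generated by the `β_c^{±1}`.
[cite: deShalit1987, III §1.4 (5); II §4.12 (33)] [cite: Washington1997, §13.2] -/
theorem map_colemanImageSubmodule₁_eq
    (hCgen : C ⊆ closure (Submonoid.closure (Set.range β ∪ Set.range fun c => fun m => ((β c) m).inv hπ (E m)) : Set _))
    (L : PowerSeries (PowerSeries 𝒪[F]))
    (hL : ∀ c : I, colemanDeltaCoinvFun hπ hq (intBase F) u hu γ (eq_zero_of_C_pi_mul_eq_zero_integer hπ) w hγ ε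
        (colemanImage hd hπ E hmono hE hdeg hσ₀ hq u hu γ hθ hcoh (hCsub (hβC c)).1 default) =
      (colemanDeltaCoinvFun hπ hq (intBase F) u hu γ (eq_zero_of_C_pi_mul_eq_zero_integer hπ) w hγ ε
          (unitTwistₗ hπ hq (intBase F) u hu γ (lubinTateChar hπ (σ c)) (TActModule.ofPS _ _ 1)) -
        PowerSeries.C ((n c : ℕ) : PowerSeries 𝒪[F])) * L) :
    (colemanImageSubmodule₁ hd hπ E hmono hE hdeg hσ₀ hq u hu γ hθ hcoh hN C hC hCsub h1 hmul hinv hgal).map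
        (colemanDeltaCoinvFun hπ hq (intBase F) u hu γ (eq_zero_of_C_pi_mul_eq_zero_integer hπ) w hγ ε) =
      Ideal.span {L} * Ideal.span (Set.range fun c =>
        colemanDeltaCoinvFun hπ hq (intBase F) u hu γ (eq_zero_of_C_pi_mul_eq_zero_integer hπ) w hγ ε
            (unitTwistₗ hπ hq (intBase F) u hu γ (lubinTateChar hπ (σ c)) (TActModule.ofPS _ _ 1)) -
          PowerSeries.C ((n c : ℕ) : PowerSeries 𝒪[F])) := by
  haveI : CompactSpace (PowerSeries 𝒪[F]) := PowerSeries.WithPiTopology.compactSpace _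
  refine map_colemanDeltaCoinvFun_eq_of_subset_closure hπ hq (intBase F) u hu γ (eq_zero_of_C_pi_mul_eq_zero_integer hπ) w hγ ε
    (exists_pow_mul_mem_nhds_intBase hπ) _ (fun c => lubinTateChar hπ (σ c)) (fun c => PowerSeries.C ((n c : ℕ) : PowerSeries 𝒪[F])) L hL
    _ (fun c => ?_) (colemanImageSubmodule₁_subset_closure hd hπ E hmono hE hdeg hσ₀ hq u hu γ hθ hcoh hN C hC hCsub h1 hmul hinv hgal β hβC hCgen)
  exact Submodule.mem_map.mpr ⟨_, (mem_colemanImageSubmodule hd hπ E hmono hE hdeg hσ₀ hq u hu γ hθ hcoh).mpr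
    (colemanImage_mem_colemanImageSet hd hπ E hmono hE hdeg hσ₀ hq u hu γ hθ hcoh (hCsub (hβC c)) (hβC c)), funUnique_coe_apply hπ hq u hu γ _⟩

include hdeg hE hσ₀ hcoh hm h1 hmul hinv hβC in
/-- ★★★ **THE LOCAL (c)-IDENTITY, CLOSURE FORM** (`q = 2`, one prime, `d = 1`, `ε`-part): for `C` closed, `Γ_F`-stable, a subgroup of `𝒰¹_∞` lying in the
closure of the monoid generated by the principal coherent tower families `β_c^{±1}`, under the auxiliary indices `a₁` (`χ(σ̃_{a₁}) = γ`, `π ∣ n_{a₁} − 1`),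
`a₂` (`(t_{χ(σ̃_{a₂})} − n_{a₂})(n_{a₁} − 1) ≠ 0`) and `L_ε ≠ 0` with `φ_ε(Col β_c) = (t_{χ(σ̃_c)} − n_c)·L_ε` for every `c`:
**`char_Λ ((N / Col C)_ε) = char_Λ (Λ ⧸ (L_ε))`**, `N = Col(𝒰¹_∞)`, `Λ = 𝒪_F⟦X⟧⟦T⟧` — the left side is that of `charIdeal_coinvariants_colemanImage_eq`.
[cite: deShalit1987, III §1.4 (5), Cor. 1.5 (7), Lemma 1.10 (17); II §4.12 (33)] [cite: Washington1997, §13.2] -/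
theorem charIdeal_coinvariants_colemanImage_eq_of_units (hε : ε * ε = 1)
    (hCgen : C ⊆ closure (Submonoid.closure (Set.range β ∪ Set.range fun c => fun m => ((β c) m).inv hπ (E m)) : Set _))
    (a₁ a₂ : I) (hv₁ : lubinTateChar hπ (σ a₁) = γ) (hn₁ : (π : 𝒪[F]) ∣ (n a₁ : 𝒪[F]) - 1)
    (ha₂ : tEval (natCast_sub_one_mem_span_intBase (F := F) hn₁)
      (colemanDeltaCoinvFun hπ hq (intBase F) u hu γ (eq_zero_of_C_pi_mul_eq_zero_integer hπ) w hγ ε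
          (unitTwistₗ hπ hq (intBase F) u hu γ (lubinTateChar hπ (σ a₂)) (TActModule.ofPS _ _ 1)) -
        PowerSeries.C ((n a₂ : ℕ) : PowerSeries 𝒪[F])) ≠ 0)
    (L : PowerSeries (PowerSeries 𝒪[F])) (hL0 : L ≠ 0)
    (hL : ∀ c : I, colemanDeltaCoinvFun hπ hq (intBase F) u hu γ (eq_zero_of_C_pi_mul_eq_zero_integer hπ) w hγ ε
        (colemanImage hd hπ E hmono hE hdeg hσ₀ hq u hu γ hθ hcoh (hCsub (hβC c)).1 default) =
      (colemanDeltaCoinvFun hπ hq (intBase F) u hu γ (eq_zero_of_C_pi_mul_eq_zero_integer hπ) w hγ ε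
          (unitTwistₗ hπ hq (intBase F) u hu γ (lubinTateChar hπ (σ c)) (TActModule.ofPS _ _ 1)) -
        PowerSeries.C ((n c : ℕ) : PowerSeries 𝒪[F])) * L) :
    Module.charIdeal (PowerSeries (PowerSeries 𝒪[F]))
        (↥(unitsImage₁ hd hπ E hmono hE hdeg hσ₀ hq u hu γ hθ hcoh hI hud) ⧸
          colemanCoinvRel hπ hq (intBase F) u hu γ ε (unitsImage₁ hd hπ E hmono hE hdeg hσ₀ hq u hu γ hθ hcoh hI hud)
            (fun _ hG => unitTwistₗ_mem_unitsImage₁ hd hπ E hmono hE hdeg hσ₀ hq u hu γ hθ hcoh hI hud (-1) hG)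
            (colemanImageSubmodule₁ hd hπ E hmono hE hdeg hσ₀ hq u hu γ hθ hcoh hN C hC hCsub h1 hmul hinv hgal)) =
      Module.charIdeal (PowerSeries (PowerSeries 𝒪[F])) (PowerSeries (PowerSeries 𝒪[F]) ⧸ Ideal.span {L}) := by
  have hmap := map_colemanImageSubmodule₁_eq hd hπ E hmono hE hdeg hσ₀ hq u hu γ w hγ hθ hcoh hN C hC hCsub h1 hmul hinv hgal β hβC ε σ n
    hCgen L hL
  exact charIdeal_colemanCoinvariants_eq_of_units_sandwich hd hπ E hmono hE hdeg hσ₀ hq u hu γ hθ hcoh w hγ ε hε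
    (fun c => (⟨β c, (hCsub (hβC c)).1⟩ : coherentFamilies hπ E hmono)) σ n a₁ a₂ hv₁ hn₁ ha₂ default L hL0 hL _ _
    (fun c => Submodule.mem_map.mpr ⟨_, (mem_colemanImageSubmodule hd hπ E hmono hE hdeg hσ₀ hq u hu γ hθ hcoh).mpr
      (colemanImage_mem_colemanImageSet hd hπ E hmono hE hdeg hσ₀ hq u hu γ hθ hcoh (hCsub (hβC c)) (hβC c)), funUnique_coe_apply hπ hq u hu γ _⟩)
    hmap.le (colemanImageSubmodule₁_le_unitsImage₁ hd hπ E hmono hE hdeg hσ₀ hq u hu γ hθ hcoh hI hud hm hN C hC hCsub h1 hmul hinv hgal) _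
    (isPseudoNull_quotient_unitsImage₁ hd hπ E hmono hE hdeg hσ₀ hq u hu γ hθ hcoh hI hud hm)

include hdeg hE hσ₀ hcoh hm h1 hmul hinv hβC in
/-- ★★ **Existence form**: under the LEVELWISE unit relation `(σ̃_c·β_{a,m})·β_{c,m}^{n_a} = (σ̃_a·β_{c,m})·β_{a,m}^{n_c}` (II §2.4 (ii); `σ̃_c` fixing `E_∞`)
and the two auxiliary indices, THE series `L_ε` exists (uniquely) and — if non-zero — **`char_Λ ((N / Col C)_ε) = char_Λ (Λ/(L_ε))`**.
[cite: deShalit1987, II §2.4 (ii), §4.12 (29)–(33); III §1.4 (5), Lemma 1.10 (17)] -/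
theorem exists_charIdeal_coinvariants_colemanImage_eq_of_units (hε : ε * ε = 1)
    (hCgen : C ⊆ closure (Submonoid.closure (Set.range β ∪ Set.range fun c => fun m => ((β c) m).inv hπ (E m)) : Set _))
    (hσE : ∀ (i : I) (m : ℕ) (x : E m), σ i • (x : AlgebraicClosure F) = x)
    (hrel : ∀ (a c : I) (m : ℕ), ((β a) m).galAct (σ c) * (β c) m ^ n a = ((β c) m).galAct (σ a) * (β a) m ^ n c)
    (a₁ a₂ : I) (hv₁ : lubinTateChar hπ (σ a₁) = γ) (hn₁ : (π : 𝒪[F]) ∣ (n a₁ : 𝒪[F]) - 1)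
    (ha₂ : tEval (natCast_sub_one_mem_span_intBase (F := F) hn₁)
      (colemanDeltaCoinvFun hπ hq (intBase F) u hu γ (eq_zero_of_C_pi_mul_eq_zero_integer hπ) w hγ ε
          (unitTwistₗ hπ hq (intBase F) u hu γ (lubinTateChar hπ (σ a₂)) (TActModule.ofPS _ _ 1)) -
        PowerSeries.C ((n a₂ : ℕ) : PowerSeries 𝒪[F])) ≠ 0) :
    ∃ L : PowerSeries (PowerSeries 𝒪[F]),
      (∀ c : I, colemanDeltaCoinvFun hπ hq (intBase F) u hu γ (eq_zero_of_C_pi_mul_eq_zero_integer hπ) w hγ ε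
          (colemanImage hd hπ E hmono hE hdeg hσ₀ hq u hu γ hθ hcoh (hCsub (hβC c)).1 default) =
        (colemanDeltaCoinvFun hπ hq (intBase F) u hu γ (eq_zero_of_C_pi_mul_eq_zero_integer hπ) w hγ ε
            (unitTwistₗ hπ hq (intBase F) u hu γ (lubinTateChar hπ (σ c)) (TActModule.ofPS _ _ 1)) -
          PowerSeries.C ((n c : ℕ) : PowerSeries 𝒪[F])) * L) ∧
      (colemanImageSubmodule₁ hd hπ E hmono hE hdeg hσ₀ hq u hu γ hθ hcoh hN C hC hCsub h1 hmul hinv hgal).map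
          (colemanDeltaCoinvFun hπ hq (intBase F) u hu γ (eq_zero_of_C_pi_mul_eq_zero_integer hπ) w hγ ε) =
        Ideal.span {L} * Ideal.span (Set.range fun c =>
          colemanDeltaCoinvFun hπ hq (intBase F) u hu γ (eq_zero_of_C_pi_mul_eq_zero_integer hπ) w hγ ε
              (unitTwistₗ hπ hq (intBase F) u hu γ (lubinTateChar hπ (σ c)) (TActModule.ofPS _ _ 1)) -
            PowerSeries.C ((n c : ℕ) : PowerSeries 𝒪[F])) ∧
      (L ≠ 0 → Module.charIdeal (PowerSeries (PowerSeries 𝒪[F]))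
          (↥(unitsImage₁ hd hπ E hmono hE hdeg hσ₀ hq u hu γ hθ hcoh hI hud) ⧸
            colemanCoinvRel hπ hq (intBase F) u hu γ ε (unitsImage₁ hd hπ E hmono hE hdeg hσ₀ hq u hu γ hθ hcoh hI hud)
              (fun _ hG => unitTwistₗ_mem_unitsImage₁ hd hπ E hmono hE hdeg hσ₀ hq u hu γ hθ hcoh hI hud (-1) hG)
              (colemanImageSubmodule₁ hd hπ E hmono hE hdeg hσ₀ hq u hu γ hθ hcoh hN C hC hCsub h1 hmul hinv hgal)) =
        Module.charIdeal (PowerSeries (PowerSeries 𝒪[F])) (PowerSeries (PowerSeries 𝒪[F]) ⧸ Ideal.span {L})) := by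
  obtain ⟨L, hL, -⟩ := existsUnique_colemanDeltaCoinvFun_colemanImageCoh_eq_mul hd hπ E hmono hE hdeg hσ₀ hq u hu γ hθ hcoh w hγ ε hε
    (fun c => (⟨β c, (hCsub (hβC c)).1⟩ : coherentFamilies hπ E hmono)) σ hσE n hrel a₁ a₂ hv₁ hn₁ ha₂ default
  exact ⟨L, hL, map_colemanImageSubmodule₁_eq hd hπ E hmono hE hdeg hσ₀ hq u hu γ w hγ hθ hcoh hN C hC hCsub h1 hmul hinv hgal β hβC ε σ n
    hCgen L hL, fun hL0 => charIdeal_coinvariants_colemanImage_eq_of_units hd hπ E hmono hE hdeg hσ₀ hq u hu γ w hγ hθ hcoh hI hud hm hN C hC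
      hCsub h1 hmul hinv hgal β hβC ε σ n hε hCgen a₁ a₂ hv₁ hn₁ ha₂ L hL0 hL⟩

end Summit.BirchSwinnertonDyer.BirchSwinnertonDyer.Theorems.PrintCf2.ColemanCoinvariantClosure

end
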